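import Summits.CriticalPhenomena.PercolationContinuityZ3.Theorems.PercNearOneGluingNoHeavyLowerTailIncStarR23EdgeChord
import HarnessLib

/-!
# The increasing star from the tangent inequality along ANY ONE pair (Sahi programme, prover prim-sahi-p2 gen 32)

Support file (`--supports stmt-CriticalPhenomena-4575`).  No definitions, no named facts, no sorries; standard axioms.
Memo `run/shared/lean/prim/prim-sahi/FROM-prim-sahi-p2-gen32-TANGENT.md` §9(d), `prim-sahi-p2/PROOF-E3.md` §42(f).

Gen 30's `IncStar.incStar_nonneg_of_ratio23` derives the increasing star `E₃({s↔b},{s↔c},{s↔y}) ≥ 0` from R23 — `2·E₃(P_{w[e↦1]}) ≤ 3·polar₁(P_{w[e↦1]},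
P_{w[e↦0]})`, i.e. `3c₂ ≥ 2c₃` for the Bernstein coefficients of `p ↦ E₃(P_{w[e↦p]})`, equivalently the TANGENT inequality `E(1) ≥ E′(1)` — along
ROOT–UNMARKED pairs `e = s(s,z)`, through the root-edge induction schema of gen 4/5.  But the cubic algebra behind it (`IncStar.contractionChord_of_ratio23`:
`c₀ ≥ 0 ∧ 3c₂ ≥ 2c₃ ⟹ w(e)·E₃(P_{w[e↦1]}) ≤ E₃(P_w)`, using only that the leading coefficient `δ_Aδ_Bδ_C` is nonnegative, `EdgeInduction.second_diff_zero_le_one`)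
holds along EVERY pair.  Hence a much more flexible induction:

* `sahiE3_star_update_diag_zero` — loops are invisible to the star (`IncStar.real_update_diag_zero`);
* **`incStar_nonneg_of_anyPairRatio23`** — if for every weight `v` having a fractional non-loop pair, and all `s b c y`, SOME fractional non-loop pair `g`
  (of the prover's choosing: root, target–target, target–unmarked, unmarked–unmarked …) satisfies R23 along `g` — where the step may assume the increasing
  star for every weight with fewer fractional pairs and every marking — then the increasing star holds on every finite weighted graph.  Equivalently: a
  minimal counterexample violates the tangent inequality along EVERY one of its fractional non-loop pairs.
* `incStar_nonneg_of_allPairRatio23` — the weaker-hypothesis form (R23 along every fractional non-loop pair, outright).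

Census (memo §9(c), kit j304103/j304105): on 34 417 pairs of random weighted graphs — every class, existing edges and added pairs — the tangent inequality for the
star events never fails; along target–target pairs it is CERTIFIED for all graphs by an exact 16-column Harris⊗cell identity in the 15-cell four-point algebra
(kit j304542; memo §10), along root–target and target–unmarked pairs no degree-3 certificate exists in that algebra.  Nothing here asserts R23.
-/

noncomputable section

namespace Summit.CriticalPhenomena.PercolationContinuityZ3.Theorems

namespace IncStar

open MeasureTheory Set Literature.Probability.Percolation Literature.Probability.LatticeModels EdgeInduction
open scoped Classical

variable {n : ℕ}

/-- Loops are invisible to the increasing star: for a diagonal pair `g`, setting `w g := 0` does not change `E₃({s↔b},{s↔c},{s↔y})`. [folklore] -/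
theorem sahiE3_star_update_diag_zero (v : Sym2 (Fin n) → unitInterval) {g : Sym2 (Fin n)} (hg : g.IsDiag) (s b c y : Fin n) :
    sahiE3 (prodBernoulli (Function.update v g 0)) (openConn s b) (openConn s c) (openConn s y) =
      sahiE3 (prodBernoulli v) (openConn s b) (openConn s c) (openConn s y) := by
  obtain ⟨h7, hA, hB, hC, hBC, hAC, hAB⟩ := star_events_sdiff_diag (n := n) hg s b c y
  simp only [sahiE3, real_update_diag_zero _ _ h7, real_update_diag_zero _ _ hA, real_update_diag_zero _ _ hB, real_update_diag_zero _ _ hC,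
    real_update_diag_zero _ _ hBC, real_update_diag_zero _ _ hAC, real_update_diag_zero _ _ hAB]

/-- Setting a fractional pair to `0` or `1` strictly decreases the number of fractional pairs. [folklore] -/
theorem card_fracEdges_update_lt' (v : Sym2 (Fin n) → unitInterval) {g : Sym2 (Fin n)} (hg : g ∈ fracEdges v) (u : unitInterval)
    (hu : u = 0 ∨ u = 1) : (fracEdges (Function.update v g u)).card < (fracEdges v).card := by
  have h1 := Finset.card_le_card (fracEdges_update_subset v g u hu)
  rw [Finset.card_erase_of_mem hg] at h1
  have hpos : 0 < (fracEdges v).card := Finset.card_pos.2 ⟨g, hg⟩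
  omega

/-- **THE INCREASING STAR FROM R23 ALONG ANY ONE PAIR.**  Suppose that for every weight `v` with at least one fractional non-loop pair and all `s b c y` —
GIVEN the increasing star for every weight with fewer fractional pairs and every marking — there is SOME fractional non-loop pair `g` with
`2·E₃(P_{v[g↦1]}) ≤ 3·polar₁(P_{v[g↦1]}, P_{v[g↦0]})` for the star events (R23 = the tangent inequality `3c₂ ≥ 2c₃` along `g`).  Then
`E₃({s↔b},{s↔c},{s↔y}) ≥ 0` under `prodBernoulli w` for every weight `w` on the pairs of `Fin n` and all `s b c y`.
Proof: strong induction on the number of fractional pairs; loops are switched off (`sahiE3_star_update_diag_zero`); at the chosen `g`, `c₀ = E₃(P_{v[g↦0]}) ≥ 0` and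
`c₃ = E₃(P_{v[g↦1]}) ≥ 0` by induction and `IncStar.contractionChord_of_ratio23` gives `E₃(P_v) ≥ v(g)·c₃ ≥ 0`; with no fractional pair the law is a point mass and
`E₃ = 0` (`EdgeInduction.sahiE3_eq_zero_of_zeroOne`). [this work] -/
theorem incStar_nonneg_of_anyPairRatio23
    (hR : ∀ (v : Sym2 (Fin n) → unitInterval) (s b c y : Fin n), (∃ g ∈ fracEdges v, ¬ g.IsDiag) →
      (∀ v' : Sym2 (Fin n) → unitInterval, (fracEdges v').card < (fracEdges v).card →
          ∀ s' b' c' y' : Fin n, 0 ≤ sahiE3 (prodBernoulli v') (openConn s' b') (openConn s' c') (openConn s' y')) →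
      ∃ g ∈ fracEdges v, ¬ g.IsDiag ∧
        2 * sahiE3 (prodBernoulli (Function.update v g 1)) (openConn s b) (openConn s c) (openConn s y) ≤
          3 * polar₁ (prodBernoulli (Function.update v g 1)) (prodBernoulli (Function.update v g 0)) (openConn s b) (openConn s c) (openConn s y)) :
    ∀ (w : Sym2 (Fin n) → unitInterval) (s b c y : Fin n),
      0 ≤ sahiE3 (prodBernoulli w) (openConn s b) (openConn s c) (openConn s y) := by
  suffices H : ∀ (k : ℕ) (v : Sym2 (Fin n) → unitInterval), (fracEdges v).card ≤ k →
      ∀ s b c y : Fin n, 0 ≤ sahiE3 (prodBernoulli v) (openConn s b) (openConn s c) (openConn s y) from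
    fun w s b c y => H _ w le_rfl s b c y
  intro k
  induction k with
  | zero =>
      intro v hk s b c y
      have hv : ∀ e, v e = 0 ∨ v e = 1 := fun e => eq_zero_or_one_of_not_mem_fracEdges fun he => by
        have : 0 < (fracEdges v).card := Finset.card_pos.2 ⟨e, he⟩
        omega
      rw [sahiE3_eq_zero_of_zeroOne v hv]
  | succ k ih =>
      intro v hk s b c y
      have IH : ∀ v' : Sym2 (Fin n) → unitInterval, (fracEdges v').card < (fracEdges v).card →
          ∀ s' b' c' y' : Fin n, 0 ≤ sahiE3 (prodBernoulli v') (openConn s' b') (openConn s' c') (openConn s' y') :=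
        fun v' hv' s' b' c' y' => ih v' (by omega) s' b' c' y'
      by_cases hex : ∃ g ∈ fracEdges v, ¬ g.IsDiag
      · obtain ⟨g, hg, hgd, h23⟩ := hR v s b c y hex IH
        have h0 : 0 ≤ sahiE3 (prodBernoulli (Function.update v g 0)) (openConn s b) (openConn s c) (openConn s y) :=
          IH _ (card_fracEdges_update_lt' v hg 0 (Or.inl rfl)) s b c y
        have h1 : 0 ≤ sahiE3 (prodBernoulli (Function.update v g 1)) (openConn s b) (openConn s c) (openConn s y) :=
          IH _ (card_fracEdges_update_lt' v hg 1 (Or.inr rfl)) s b c y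
        have hco := contractionChord_of_ratio23 v g (isUpperSet_openConn s b) (isUpperSet_openConn s c) (isUpperSet_openConn s y) h0 h23
        have hp : (0 : ℝ) ≤ v g := (v g).2.1
        nlinarith [mul_nonneg hp h1]
      · push Not at hex
        by_cases hne : (fracEdges v).Nonempty
        · -- only loops are fractional: switch one off
          obtain ⟨g, hg⟩ := hne
          have hgd : g.IsDiag := hex g hg
          rw [← sahiE3_star_update_diag_zero v hgd s b c y]
          exact IH _ (card_fracEdges_update_lt' v hg 0 (Or.inl rfl)) s b c y
        · rw [Finset.not_nonempty_iff_eq_empty] at hne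
          have hv : ∀ e, v e = 0 ∨ v e = 1 := fun e => eq_zero_or_one_of_not_mem_fracEdges (by rw [hne]; simp)
          rw [sahiE3_eq_zero_of_zeroOne v hv]

/-- The same with R23 along every fractional non-loop pair assumed outright (no choice, no induction hypothesis): if `3c₂ ≥ 2c₃` holds along every fractional
non-loop pair of every weight for the star events, the increasing star holds on every finite weighted graph. [this work] -/
theorem incStar_nonneg_of_allPairRatio23
    (hR : ∀ (v : Sym2 (Fin n) → unitInterval) (s b c y : Fin n) (g : Sym2 (Fin n)), g ∈ fracEdges v → ¬ g.IsDiag →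
      2 * sahiE3 (prodBernoulli (Function.update v g 1)) (openConn s b) (openConn s c) (openConn s y) ≤
        3 * polar₁ (prodBernoulli (Function.update v g 1)) (prodBernoulli (Function.update v g 0)) (openConn s b) (openConn s c) (openConn s y)) :
    ∀ (w : Sym2 (Fin n) → unitInterval) (s b c y : Fin n),
      0 ≤ sahiE3 (prodBernoulli w) (openConn s b) (openConn s c) (openConn s y) :=
  incStar_nonneg_of_anyPairRatio23 fun v s b c y hex _ => by
    obtain ⟨g, hg, hgd⟩ := hex
    exact ⟨g, hg, hgd, hR v s b c y g hg hgd⟩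

end IncStar

end Summit.CriticalPhenomena.PercolationContinuityZ3.Theorems

end
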